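import Summits.BirchSwinnertonDyer.BirchSwinnertonDyer.Theorems.LeadingTermConsistencySplit
import HarnessLib

/-!
# BirchSwinnertonDyer / LeadingTerm — glue item `ConsistencySplitGlue` (stmt-BirchSwinnertonDyer-23294) holds

The crux-strategist split (r1, 2026-08-28, route rev 12) of crux #2 `Consistency`
(stmt-BirchSwinnertonDyer-16217) into child A `ConsistencyNonDeficient` (stmt-23292, the crux on the cells
`r_an ≤ r_MW`) and child B `DeficientVanishing` (stmt-23293, `r_MW < r_an ⇒ [T^{r_MW}]L_p(f,α_p,T) = 0`)
carries the glue item `ConsistencySplitGlue : ConsistencyNonDeficient → DeficientVanishing → Consistency`.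
Its proof is the landed theorem `consistency_of_nonDeficient_of_deficientVanishing`
(`Theorems/LeadingTermConsistencySplit`, p661901): case split on `r_an ≤ r_MW`; in a deficient cell both
leading-term identities hold with `q = 0`. The children there are spelled out verbatim, so the route decls
unfold to them definitionally.
-/

set_option linter.dupNamespace false

namespace Summit.BirchSwinnertonDyer.BirchSwinnertonDyer.Theorems

/-- **The glue item of the split of `Consistency` holds**: children ⟹ parent. [folklore] -/
theorem consistencySplitGlue_holds :
    Summit.BirchSwinnertonDyer.BirchSwinnertonDyer.Theses.LeadingTerm.ConsistencySplitGlue :=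
  fun hA hB => consistency_of_nonDeficient_of_deficientVanishing hA hB

/-- The same, with the three route decls by name in colon form. [folklore] -/
theorem consistency_of_children
    (hA : Summit.BirchSwinnertonDyer.BirchSwinnertonDyer.Theses.LeadingTerm.ConsistencyNonDeficient)
    (hB : Summit.BirchSwinnertonDyer.BirchSwinnertonDyer.Theses.LeadingTerm.DeficientVanishing) :
    Summit.BirchSwinnertonDyer.BirchSwinnertonDyer.Theses.LeadingTerm.Consistency :=
  consistency_of_nonDeficient_of_deficientVanishing hA hB

/-- Exactness by name: the crux is EQUIVALENT to the conjunction of its two children. [folklore] -/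
theorem consistency_iff_children :
    Summit.BirchSwinnertonDyer.BirchSwinnertonDyer.Theses.LeadingTerm.Consistency ↔
      (Summit.BirchSwinnertonDyer.BirchSwinnertonDyer.Theses.LeadingTerm.ConsistencyNonDeficient ∧
        Summit.BirchSwinnertonDyer.BirchSwinnertonDyer.Theses.LeadingTerm.DeficientVanishing) :=
  consistency_iff_nonDeficient_and_deficientVanishing

/-- Child B by name decides the summit with the route's other two `closes` hypotheses (the re-glue a
tenure planner may install: `closes (hDV : DeficientVanishing) (hP : PinchPrime) (hUB : SqueezeUBR2)`).
[folklore] -/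
theorem bsd_of_deficientVanishing_item
    (hB : Summit.BirchSwinnertonDyer.BirchSwinnertonDyer.Theses.LeadingTerm.DeficientVanishing)
    (hP : Summit.BirchSwinnertonDyer.BirchSwinnertonDyer.Theses.LeadingTerm.PinchPrime)
    (hUB : Summit.BirchSwinnertonDyer.BirchSwinnertonDyer.Theses.LeadingTerm.SqueezeUBR2) :
    _root_.BirchSwinnertonDyer :=
  bsd_of_deficientVanishing_of_pinchPrime_of_squeezeUB hB hP hUB

/-- Child B by name is WITHIN the summit: BSD-rank empties every deficient cell. [folklore] -/
theorem deficientVanishing_item_of_bsd (h : _root_.BirchSwinnertonDyer) :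
    Summit.BirchSwinnertonDyer.BirchSwinnertonDyer.Theses.LeadingTerm.DeficientVanishing :=
  deficientVanishing_of_bsd h

end Summit.BirchSwinnertonDyer.BirchSwinnertonDyer.Theorems
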